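import Literature.MathematicalPhysics.QuantumLattice.NarrowWellPlaquetteAction
import Literature.MathematicalPhysics.QuantumLattice.GaugeGroupsProofs
import Literature.MathematicalPhysics.QuantumLattice.PlaquetteWeightFreeEnergyLimit
import Literature.MathematicalPhysics.QuantumFieldTheory.YangMillsOS
import Summits.QuantumFields.YangMills.Theorems.GronwallGapAnalyticDetourStubTorusPartitionDictionary

/-!
# Crux `AnalyticDetour` (stmt-QuantumFields-8801), line `registered`:
# the exceptional set `E` is NECESSARY — already for `G = SU(2)` (modulo van Enter–Shlosman)

Route `GronwallGap`, sub-problem `YangMills`.  The crux asks, for every compact simple `G` and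
every faithful unitary lattice representation `r`, for admissible analytic weight paths to every
Wilson point `β ∉ E`, with `E` a locally finite EXCEPTIONAL SET.  This file shows that `E`
cannot be dropped, and that the hypothesis of the crossover corollary
`analyticDetour_of_wilsonAxisAnalytic` (Wilson-axis Gateaux-analyticity for ALL `(G, r)`) is
FALSE — rigorously modulo ONE named published fact,
`Literature.MathematicalPhysics.QuantumLattice.enterShlosman_narrowWell_firstOrderTransition`
(van Enter–Shlosman 2005, Thm. 2: the narrow-well plaquette action `J((1 + ½Re tr U)/2)^p` on
`SU(2)` has, for `p` large and `d ≥ 3`, a coupling `J_t > 0` where the torus pressure is not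
differentiable).

Mechanism (`stub_wilsonAxisAnalyticAllFalse`): by the folklore identity
`NarrowWell.trace_re_rep`, the narrow-well action with exponent `p₀ + 1` IS Wilson's action
`β Re tr ρ(U)` for the faithful continuous unitary representation `ρ = (ℂ² ⊕ ℂ ⊕ ℂ)^{⊗(p₀+1)}`
of `SU(2)` (a `LatticeRep`, packaged here by the anonymous constructor), at `β = J / 4^{p₀+1}`.
Gateaux-analyticity of the Wilson pressure of `ρ` at `β_t = J_t / 4^{p₀+1}` in the class
direction `φ = Re tr ρ` would make `t ↦ P(J_t + 4^{p₀+1} t)` analytic at `0` (the crux's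
`withDensity` pressure is identified with the tree's torus pressure by the landed dictionary
`stub_torusPartitionDictionary`, and limits are unique), contradicting the fact.  Hence
(`stub_analyticDetourFalseWithoutE`) the crux with `E = ∅` forced is false: at `s = 1` its path
clause contains exactly that analyticity.  `SU(2)` is a certified compact simple Lie group
(`isSimpleCompactGroup_specialUnitaryGroup_holds`).

Reading for the line: any proof of `AnalyticDetour` must put the van Enter–Shlosman couplings
into `E(r)` and construct genuine off-axis DETOURS for such `r` — even when `G = SU(2)`; the
"Wilson segment, `E = ∅`" witness is available at best representation by representation.
Both theorems are CONDITIONAL on the named fact (hypothesis, not an axiom); no definitions.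
-/

noncomputable section

namespace Summit.QuantumFields.YangMills.Theorems

open scoped BigOperators
open Literature.MathematicalPhysics.QuantumLattice Literature.MathematicalPhysics.QuantumFieldTheory

/-- **Wilson-axis Gateaux-analyticity for all `(G, r)` is FALSE (modulo van Enter–Shlosman).**
For `G = SU(2)` and `r = (ℂ² ⊕ ℂ ⊕ ℂ)^{⊗(p₀+1)}` the Wilson pressure is not Gateaux-analytic in
the direction `Re tr r` at `β_t = J_t / 4^{p₀+1}`. -/
theorem stub_wilsonAxisAnalyticAllFalse :
    Literature.MathematicalPhysics.QuantumLattice.enterShlosman_narrowWell_firstOrderTransition → ¬ (∀ (G : Type) [Group G] [TopologicalSpace G] [IsTopologicalGroup G] [CompactSpace G], Literature.MathematicalPhysics.QuantumFieldTheory.IsCompactSimpleLieGroup G → letI : MeasurableSpace G := borel G; haveI : BorelSpace G := ⟨rfl⟩; let Pseq : (G → ℝ) → ℕ → ℝ := fun v L => (((L + 1 : ℕ) : ℝ) ^ 4)⁻¹ * Real.log (((MeasureTheory.Measure.pi fun _ : Literature.MathematicalPhysics.QuantumFieldTheory.Edge 4 (L + 1) => Literature.MathematicalPhysics.QuantumFieldTheory.haarProbability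 G).withDensity (fun U : Literature.MathematicalPhysics.QuantumFieldTheory.GaugeConfig 4 (L + 1) G => ENNReal.ofReal (Literature.MathematicalPhysics.QuantumLattice.groupHeatKernelWeight (fun _ : ℝ => v) 0 U))) Set.univ).toReal; let AnP : (G → ℝ) → Prop := fun v => ∀ φ : G → ℝ, Continuous φ → (∀ g h : G, φ (h * g * h⁻¹) = φ g) → ∃ p : ℝ → ℝ, (∀ t : ℝ, Filter.Tendsto (fun L : ℕ => Pseq (fun g => v g * Real.exp (t * φ g)) L) Filter.atTop (nhds (p t))) ∧ AnalyticAt ℝ p 0; ∀ r : Literature.MathematicalPhysics.QuantumFieldTheory.LatticeRep G, ∀ β : ℝ, 0 < β → AnP (fun g => Real.exp (β * (r.ρ g).trace.re))) := by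
  intro hES hax
  obtain ⟨p₀, hp₀⟩ := hES 4 (by norm_num)
  have key := hp₀ (p₀ + 1) (Nat.le_succ _)
  -- the torus pressure of the narrow-well weight exists for every coupling (tree theorem)
  have hFc : Continuous (NarrowWell.weight (p₀ + 1)) := NarrowWell.continuous_weight _
  have hlim : ∀ J : ℝ, ∃ PJ : ℝ, Filter.Tendsto (fun L : ℕ => (((L + 1 : ℕ) : ℝ) ^ 4)⁻¹ *
      Real.log (∫ U : GaugeConfig 4 (L + 1) (Matrix.specialUnitaryGroup (Fin 2) ℂ),
        ∏ q : Plaquette 4 (L + 1),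
          Real.exp (J * NarrowWell.weight (p₀ + 1) (plaquetteHolonomy U q.1 q.2.1.1 q.2.1.2))
        ∂(MeasureTheory.Measure.pi fun _ : Edge 4 (L + 1) =>
          haarProbability (Matrix.specialUnitaryGroup (Fin 2) ℂ))))
      Filter.atTop (nhds PJ) := fun J =>
    tendsto_torusPressure_of_continuous_pos (d := 4)
      (v := fun g => Real.exp (J * NarrowWell.weight (p₀ + 1) g))
      (Real.continuous_exp.comp (continuous_const.mul hFc)) (fun g => Real.exp_pos _)
  choose P hP using hlim
  obtain ⟨Jt, hJt, hndiff⟩ := key P hP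
  -- the van Enter–Shlosman representation as lattice-representation data, and the coupling
  let r : LatticeRep (Matrix.specialUnitaryGroup (Fin 2) ℂ) :=
    ⟨_, NarrowWell.rep p₀, NarrowWell.continuous_rep p₀, NarrowWell.rep_injective p₀,
      NarrowWell.rep_mem_unitaryGroup p₀⟩
  set c : ℝ := (4 : ℝ) ^ (p₀ + 1) with hc
  have hcpos : 0 < c := by positivity
  have hT : ∀ g, ((r.ρ g).trace).re = c * NarrowWell.weight (p₀ + 1) g :=
    fun g => NarrowWell.trace_re_rep p₀ g
  have hTc : Continuous fun g => ((r.ρ g).trace).re :=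
    Complex.continuous_re.comp r.continuous.matrix_trace
  have hTcl : ∀ g h, ((r.ρ (h * g * h⁻¹)).trace).re = ((r.ρ g).trace).re := by
    intro g h
    rw [map_mul, map_mul, Matrix.trace_mul_cycle, ← map_mul, inv_mul_cancel, map_one, one_mul]
  have hG : IsCompactSimpleLieGroup (Matrix.specialUnitaryGroup (Fin 2) ℂ) :=
    isCompactSimpleLieGroup_specialUnitaryGroup isSimpleCompactGroup_specialUnitaryGroup_holds le_rfl
  obtain ⟨q, hq, hqan⟩ := hax (Matrix.specialUnitaryGroup (Fin 2) ℂ) hG r (Jt / c) (by positivity)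
    (fun g => ((r.ρ g).trace).re) hTc hTcl
  -- identify the crux's pressure sequence in direction `Re tr r` with the narrow-well pressures
  have hv : ∀ t : ℝ, Continuous fun g =>
      Real.exp (Jt / c * ((r.ρ g).trace).re) * Real.exp (t * ((r.ρ g).trace).re) :=
    fun t => (Real.continuous_exp.comp (continuous_const.mul hTc)).mul
      (Real.continuous_exp.comp (continuous_const.mul hTc))
  have hvpos : ∀ (t : ℝ) (g : Matrix.specialUnitaryGroup (Fin 2) ℂ),
      0 < Real.exp (Jt / c * ((r.ρ g).trace).re) * Real.exp (t * ((r.ρ g).trace).re) :=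
    fun t g => mul_pos (Real.exp_pos _) (Real.exp_pos _)
  have key2 : ∀ t : ℝ, Filter.Tendsto (fun L : ℕ => (((L + 1 : ℕ) : ℝ) ^ 4)⁻¹ *
      Real.log (((MeasureTheory.Measure.pi fun _ : Edge 4 (L + 1) =>
        haarProbability (Matrix.specialUnitaryGroup (Fin 2) ℂ)).withDensity
        (fun U : GaugeConfig 4 (L + 1) (Matrix.specialUnitaryGroup (Fin 2) ℂ) =>
          ENNReal.ofReal (groupHeatKernelWeight
            (fun _ : ℝ => fun g => Real.exp (Jt / c * ((r.ρ g).trace).re) *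
              Real.exp (t * ((r.ρ g).trace).re)) 0 U))) Set.univ).toReal)
      Filter.atTop (nhds (P (Jt + c * t))) := by
    intro t
    refine (hP (Jt + c * t)).congr' (Filter.Eventually.of_forall fun L => ?_)
    dsimp only
    rw [(stub_torusPartitionDictionary (Matrix.specialUnitaryGroup (Fin 2) ℂ) L _ (hv t)
      (hvpos t)).2]
    congr 2
    refine MeasureTheory.integral_congr_ae (Filter.Eventually.of_forall fun U => ?_)
    refine Finset.prod_congr rfl fun x _ => ?_
    rw [← Real.exp_add, hT]
    congr 1
    field_simp
  have hqP : ∀ t : ℝ, q t = P (Jt + c * t) := fun t => tendsto_nhds_unique (hq t) (key2 t)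
  have hPq : P = fun J => q ((J - Jt) / c) := by
    funext J
    rw [hqP]
    congr 1
    field_simp
    ring
  apply hndiff
  rw [hPq]
  have h0 : (Jt - Jt) / c = 0 := by simp
  refine DifferentiableAt.comp Jt ?_ ((differentiableAt_id.sub_const Jt).div_const c)
  rw [h0]
  exact hqan.differentiableAt

/-- **The exceptional set of `AnalyticDetour` cannot be dropped (modulo van Enter–Shlosman).**
The strengthening of the crux with `E = ∅` — admissible analytic paths from the strong-coupling
window to EVERY Wilson point `β > 0` — is false: at `s = 1` it yields Gateaux-analyticity of the
Wilson pressure for all `(G, r, β)`, refuted by `stub_wilsonAxisAnalyticAllFalse`. -/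
theorem stub_analyticDetourFalseWithoutE :
    Literature.MathematicalPhysics.QuantumLattice.enterShlosman_narrowWell_firstOrderTransition → ¬ (∀ (G : Type) [Group G] [TopologicalSpace G] [IsTopologicalGroup G] [CompactSpace G], Literature.MathematicalPhysics.QuantumFieldTheory.IsCompactSimpleLieGroup G → letI : MeasurableSpace G := borel G; haveI : BorelSpace G := ⟨rfl⟩; let Pseq : (G → ℝ) → ℕ → ℝ := fun v L => (((L + 1 : ℕ) : ℝ) ^ 4)⁻¹ * Real.log (((MeasureTheory.Measure.pi fun _ : Literature.MathematicalPhysics.QuantumFieldTheory.Edge 4 (L + 1) => Literature.MathematicalPhysics.QuantumFieldTheory.haarProbability G).withDensity (fun U : Literature.MathematicalPhysics.QuantumFieldTheory.GaugeConfig 4 (L + 1) G => ENNReal.ofReal (Literature.MathematicalPhysics.QuantumLattice.groupHeatKernelWeight (fun _ : ℝ => v) 0 U))) Set.univ).toReal; let AnP : (G → ℝ) → Prop := fun v => ∀ φ : G → ℝ, Continuous φ → (∀ g h : G, φ (h * g * h⁻¹) = φ g) → ∃ p : ℝ → ℝ, (∀ t : ℝ, Filter.Tendsto (fun L : ℕ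 => Pseq (fun g => v g * Real.exp (t * φ g)) L) Filter.atTop (nhds (p t))) ∧ AnalyticAt ℝ p 0; let Adm : (ℝ → G → ℝ) → Prop := fun w => (∀ s ∈ Set.Icc (0 : ℝ) 1, Continuous (w s) ∧ (∀ g : G, 0 < w s g) ∧ (∀ g h : G, w s (h * g * h⁻¹) = w s g) ∧ (∀ g : G, w s g⁻¹ = w s g) ∧ (∀ (n : ℕ) (x : Fin n → G) (c : Fin n → ℂ), 0 ≤ (∑ i, ∑ j, (starRingEnd ℂ) (c i) * c j * ((w s ((x i)⁻¹ * x j) : ℝ) : ℂ)).re)) ∧ ∃ Λ : ℝ, ∀ s ∈ Set.Icc (0 : ℝ) 1, ∀ s' ∈ Set.Icc (0 : ℝ) 1, ∀ g : G, |Real.log (w s g) - Real.log (w s' g)| ≤ Λ * |s - s'|; ∀ r : Literature.MathematicalPhysics.QuantumFieldTheory.LatticeRep G, ∃ β₁ : ℝ, 0 < β₁ ∧ ∀ β : ℝ, 0 < β → ∀ βs ∈ Set.Ioo (0 : ℝ) β₁, ∃ w : ℝ → G → ℝ, Adm w ∧ (∀ s ∈ Set.Icc (0 : ℝ) 1, AnP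 (w s)) ∧ w 0 = (fun g => Real.exp (βs * (r.ρ g).trace.re)) ∧ w 1 = (fun g => Real.exp (β * (r.ρ g).trace.re))) := by
  intro hES h
  refine stub_wilsonAxisAnalyticAllFalse hES ?_
  intro G i1 i2 i3 i4 hG Pseq AnP r β hβ
  obtain ⟨β₁, hβ₁, hpath⟩ := h G hG r
  obtain ⟨w, -, hAn, -, hw1⟩ := hpath β hβ (β₁ / 2) ⟨by positivity, by linarith⟩
  have := hAn 1 ⟨zero_le_one, le_rfl⟩
  rwa [hw1] at this

end Summit.QuantumFields.YangMills.Theorems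

end
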